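import Summits.AtomisticToContinuum.HydrodynamicLimit.Theorems.JParityClosureEvenStressEnskogVelocityTruncationOfTails
import Summits.AtomisticToContinuum.HydrodynamicLimit.Theorems.JParityClosureOddContactSymmetryGibbsInvariance
import HarnessLib

/-!
# Rung 0 of the energy tail (H_E) of S1: the homogeneous Gibbs law
# (`stub_velocityTailEnergyRung0`, line `even-rung-mean-variance`, crux `JParityClosure.EvenStressEnskog`,
# stmt-AtomisticToContinuum-13079)

The second antecedent (H_E) of `stub_velocityTruncationOfTails` — smallness of the fixed-time means of
the tail kinetic energy per particle `T_L = tailEnergy L` (`CollisionTailMarks`) under the evolved local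
Gibbs law, uniformly on `[0, τ]` — holds at RUNG 0 (constant profiles `(a, u, θ)`): the homogeneous Gibbs
law `G_N = localGibbsLaw σ a u θ N Φ` is invariant under EVERY hard-sphere flow
(`Theorems.map_flow_localGibbsLaw_const`), so the fixed-time mean is the static one; disintegrating
`G_N` into positions and i.i.d. Gaussian velocities (`lintegral_localGibbsMeasure`,
`lintegral_posWeight_eq_one`) it equals the Gaussian velocity tail `gaussVelTail u θ L` EXACTLY
(`lintegral_tailEnergy_flow_const`), for every flow, time and particle number, and
`gaussVelTail u θ L → 0` (`tendsto_gaussVelTail`).  Whence `velocityTailEnergy_rung0` (the body of (H_E)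
at constant profiles, `σ₀ = 1/2`, `N₀ = 0`), the registered helper stub `stub_velocityTailEnergyRung0`
(its `∀`-form), and `velocityTruncation_rung0_of_collisionTail`: AT RUNG 0, S1 follows from the rung-0
collision tail (H_K) ALONE (`velocityTruncation_of_tails_at`).

References: H. Spohn, *Large Scale Dynamics of Interacting Particles* (1991), Part I §2.3
(equilibrium measures are invariant; Maxwellian velocities).
-/

noncomputable section

open MeasureTheory Set Filter Topology
open scoped ENNReal InnerProductSpace BigOperators

namespace Summit.AtomisticToContinuum.HydrodynamicLimit.Theorems.EvenStressEnskog

open Literature.Analysis.FluidPDE Literature.MathematicalPhysics.KineticTheory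

/-! ## The fixed-time energy tail under the homogeneous Gibbs law -/

/-- **Rung 0 · the fixed-time energy tail under the homogeneous Gibbs law is the static Gaussian
tail.**  For constant profiles `(a, u, θ)` with `θ > 0`, every reduced diameter `σ ≤ 1/2` (so that the
law is a probability measure), EVERY hard-sphere flow, time, truncation level and particle number:
`∫ T_L(Φ_s z) dG_N(z) = t(u, θ, L)` — invariance of the Gibbs law (`map_flow_localGibbsLaw_const`),
disintegration into positions and i.i.d. Gaussian velocities (`lintegral_localGibbsMeasure`), and
`∫ (N+1)⁻¹ Σᵢ t_L(vᵢ) ⊗N(u,θ) = t(u, θ, L)`. [folklore] -/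
theorem lintegral_tailEnergy_flow_const (a : ℝ) (u : V3) {θ : ℝ} (ha : 0 < a) (hθ : 0 < θ) {σ : ℝ}
    (hσ : σ ≤ 1 / 2) (N : ℕ) (Φ : HardSphereFlow (Torus.geometry (Fin 3)) (hsDiameter σ N) (N + 1))
    (s L : ℝ) :
    ∫⁻ z, ENNReal.ofReal (tailEnergy L (Φ.flow s z))
        ∂(localGibbsLaw σ (fun _ => a) (fun _ => u) (fun _ => θ) N Φ) = gaussVelTail u θ L := by
  have hmeas : Measurable fun z : Config (N + 1) (Fin 3) T3 => ENNReal.ofReal (tailEnergy L z) :=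
    (measurable_tailEnergy L).ennreal_ofReal
  -- invariance of the Gibbs law
  have h1 : ∫⁻ z, ENNReal.ofReal (tailEnergy L (Φ.flow s z))
      ∂(localGibbsLaw σ (fun _ => a) (fun _ => u) (fun _ => θ) N Φ) =
      ∫⁻ z, ENNReal.ofReal (tailEnergy L z) ∂(localGibbsLaw σ (fun _ => a) (fun _ => u) (fun _ => θ) N Φ) := by
    rw [← lintegral_map hmeas (Φ.measurable_flow s), map_flow_localGibbsLaw_const]
  rw [h1, localGibbsLaw_eq]
  haveI := isProbabilityMeasure_localGibbsMeasure (a₀ := fun _ => a) (θ₀ := fun _ => θ) (u₀ := fun _ => u)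
    continuous_const continuous_const continuous_const (fun _ => ha) (fun _ => hθ) hσ N
  rw [lintegral_localGibbsMeasure continuous_const continuous_const continuous_const
    (fun _ => ha.le) (fun _ => hθ) σ N hmeas]
  -- the velocity integral, for fixed positions
  have hn0 : ((N + 1 : ℕ) : ℝ≥0∞) ≠ 0 := by exact_mod_cast Nat.succ_ne_zero N
  have hnt : ((N + 1 : ℕ) : ℝ≥0∞) ≠ ∞ := ENNReal.natCast_ne_top _
  have hinner : ∀ x : Fin (N + 1) → T3,
      ∫⁻ v, ENNReal.ofReal (tailEnergy L (zipConfig (x, v))) ∂velMeasure (fun _ => u) (fun _ => θ) x =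
        gaussVelTail u θ L := by
    intro x
    have hpt : ∀ v : Fin (N + 1) → V3, ENNReal.ofReal (tailEnergy L (zipConfig (x, v))) =
        ((N + 1 : ℕ) : ℝ≥0∞)⁻¹ * ∑ i, ENNReal.ofReal (velTail L (v i)) := by
      intro v
      unfold tailEnergy
      simp only [zipConfig_apply]
      rw [ENNReal.ofReal_mul (inv_nonneg.2 (Nat.cast_nonneg _)),
        ENNReal.ofReal_inv_of_pos (by exact_mod_cast Nat.succ_pos N), ENNReal.ofReal_natCast,
        ENNReal.ofReal_sum_of_nonneg fun i _ => velTail_nonneg L _]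
    simp_rw [hpt]
    have hmi : ∀ i : Fin (N + 1), Measurable fun v : Fin (N + 1) → V3 => ENNReal.ofReal (velTail L (v i)) :=
      fun i => ((measurable_velTail L).comp (measurable_pi_apply i)).ennreal_ofReal
    rw [lintegral_const_mul _ (Finset.measurable_sum _ fun i _ => hmi i),
      lintegral_finsetSum _ fun i _ => hmi i]
    have hterm : ∀ i : Fin (N + 1),
        ∫⁻ v, ENNReal.ofReal (velTail L (v i)) ∂velMeasure (fun _ => u) (fun _ => θ) x = gaussVelTail u θ L := by
      intro i
      unfold velMeasure gaussVelTail
      exact (measurePreserving_eval (fun j : Fin (N + 1) => gaussMeasure ((fun _ => u) (x j))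
        ((fun _ => θ) (x j))) i).lintegral_comp (measurable_velTail L).ennreal_ofReal
    simp_rw [hterm]
    rw [Finset.sum_const, Finset.card_univ, Fintype.card_fin, nsmul_eq_mul, ← mul_assoc,
      ENNReal.inv_mul_cancel hn0 hnt, one_mul]
  simp_rw [hinner]
  have hρm : Measurable fun x : Fin (N + 1) → T3 => ENNReal.ofReal
      ((canonicalPartition (Torus.geometry (Fin 3)) (hsDiameter σ N) (N + 1)
        (localGibbsProfile (fun _ => a) (fun _ => u) fun _ => θ))⁻¹ *
          posWeight (fun _ => a) (hsDiameter σ N) (N + 1) x) :=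
    (measurable_const.mul (measurable_posWeight continuous_const _ _)).ennreal_ofReal
  rw [lintegral_mul_const _ hρm,
    lintegral_posWeight_eq_one continuous_const continuous_const continuous_const (fun _ => ha.le)
      (fun _ => hθ) σ N, one_mul]

/-- **Rung 0 of (H_E), uniformly in the flow, the time and the particle number.**  For constant
profiles `(a, u, θ)`, `a, θ > 0`, `σ ≤ 1/2` and `η > 0` there is `L₀` such that for all `L ≥ L₀`, all `N`,
all flows and all times: `∫ T_L(Φ_s z) dG_N(z) ≤ η`. [folklore] -/
theorem lintegral_tailEnergy_flow_const_le (a : ℝ) (u : V3) {θ : ℝ} (ha : 0 < a) (hθ : 0 < θ) {σ : ℝ}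
    (hσ : σ ≤ 1 / 2) {η : ℝ} (hη : 0 < η) :
    ∃ L₀ : ℝ, ∀ L : ℝ, L₀ ≤ L → ∀ (N : ℕ)
      (Φ : HardSphereFlow (Torus.geometry (Fin 3)) (hsDiameter σ N) (N + 1)) (s : ℝ),
      ∫⁻ z, ENNReal.ofReal (tailEnergy L (Φ.flow s z))
        ∂(localGibbsLaw σ (fun _ => a) (fun _ => u) (fun _ => θ) N Φ) ≤ ENNReal.ofReal η := by
  have hη' : (0 : ℝ≥0∞) < ENNReal.ofReal η := ENNReal.ofReal_pos.2 hη
  obtain ⟨L₀, hL₀⟩ := eventually_atTop.1 ((tendsto_gaussVelTail u θ).eventually (gt_mem_nhds hη'))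
  refine ⟨L₀, fun L hL N Φ s => ?_⟩
  rw [lintegral_tailEnergy_flow_const a u ha hθ hσ N Φ s L]
  exact (hL₀ L hL).le

/-- **Rung 0 of (H_E)** (the second antecedent of `stub_velocityTruncationOfTails` at constant profiles,
in its own frame, with
`σ₀ = 1/2` and `N₀ = 0`). [folklore] -/
theorem velocityTailEnergy_rung0 (a θ : ℝ) (u : V3) (ha : 0 < a) (hθ : 0 < θ) :
    ∃ σ₀ : ℝ, 0 < σ₀ ∧ ∀ σ : ℝ, 0 < σ → σ < σ₀ →
    ∀ Φ : (N : ℕ) → HardSphereFlow (Torus.geometry (Fin 3)) (hsDiameter σ N) (N + 1),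
    ∀ τ : ℝ, 0 < τ → ∀ η : ℝ, 0 < η → ∃ L₀ : ℝ, ∀ L : ℝ, L₀ ≤ L → ∃ N₀ : ℕ, ∀ N : ℕ, N₀ ≤ N →
    ∀ s ∈ Icc (0 : ℝ) τ,
      ∫⁻ z, ENNReal.ofReal (tailEnergy L ((Φ N).flow s z))
        ∂(localGibbsLaw σ (fun _ => a) (fun _ => u) (fun _ => θ) N (Φ N)) ≤ ENNReal.ofReal η := by
  refine ⟨1 / 2, by norm_num, fun σ _ hσ Φ τ _ η hη => ?_⟩
  obtain ⟨L₀, hL₀⟩ := lintegral_tailEnergy_flow_const_le a u ha hθ hσ.le hη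
  exact ⟨L₀, fun L hL => ⟨0, fun N _ s _ => hL₀ L hL N (Φ N) s⟩⟩


/-! ## Rung 0 of S1 from the rung-0 collision tail -/

/-- **Rung 0 of S1 needs only the rung-0 collision tail.**  For constant profiles `(a, u, θ)`,
`a, θ > 0`, and a threshold `ηK > 0`: the per-profile body of (H_K) (the collision tail) ALONE gives
the per-profile body of S1 with threshold `min ηK ηY` (`ηY` the band of `exists_contactValue_bound`),
the energy tail being supplied by `velocityTailEnergy_rung0`. [folklore] -/
theorem velocityTruncation_rung0_of_collisionTail {ηK : ℝ} (a θ : ℝ) (u : V3) (ha : 0 < a) (hθ : 0 < θ)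
    (hηK : 0 < ηK)
    (hK : ∃ σ₀ : ℝ, 0 < σ₀ ∧ ∀ σ : ℝ, 0 < σ → σ < σ₀ →
      ∀ Φ : (N : ℕ) → HardSphereFlow (Torus.geometry (Fin 3)) (hsDiameter σ N) (N + 1),
      ∀ τ : ℝ, 0 < τ → ∀ g : ℝ → ℝ, Continuous g → (∀ b, ηK ≤ b → g b = 0) → (∀ b, 0 ≤ g b) →
      ∀ η δ : ℝ, 0 < η → 0 < δ → ∃ r₀ : ℝ, 0 < r₀ ∧ ∀ r : ℝ, 0 < r → r < r₀ →
      ∃ L₀ : ℝ, ∀ L : ℝ, L₀ ≤ L → ∃ N₀ : ℕ, ∀ N : ℕ, N₀ ≤ N →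
        localGibbsLaw σ (fun _ => a) (fun _ => u) (fun _ => θ) N (Φ N)
          {z | η < collisionSum σ N (Φ N) τ (fun _ => 1) g (speedTailMark L) r z} ≤ ENNReal.ofReal δ) :
    ∃ η₀ : ℝ, 0 < η₀ ∧ ∃ σ₀ : ℝ, 0 < σ₀ ∧ ∀ σ : ℝ, 0 < σ → σ < σ₀ →
      ∀ Φ : (N : ℕ) → HardSphereFlow (Torus.geometry (Fin 3)) (hsDiameter σ N) (N + 1),
      ∀ τ : ℝ, 0 < τ → ∀ χ : ℝ × UnitAddTorus (Fin 3) → ℝ, Continuous χ → ∀ g : ℝ → ℝ, Continuous g →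
      (∀ b, η₀ ≤ b → g b = 0) →
      ∀ η δ : ℝ, 0 < η → 0 < δ → ∃ r₀ : ℝ, 0 < r₀ ∧ ∀ r : ℝ, 0 < r → r < r₀ →
      ∃ L₀ : ℝ, ∀ L : ℝ, L₀ ≤ L → ∃ N₀ : ℕ, ∀ N : ℕ, N₀ ≤ N → ∀ k l : Fin 3,
        localGibbsLaw σ (fun _ => a) (fun _ => u) (fun _ => θ) N (Φ N)
          {z | η < |evenStat σ N (Φ N) τ χ g (evenMark k l) r z -
              evenStat σ N (Φ N) τ χ g (evenMarkTrunc k l L) r z|}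
          ≤ ENNReal.ofReal δ := by
  obtain ⟨ηY, hηY, CY, hCY⟩ := exists_contactValue_bound
  exact ⟨min ηK ηY, lt_min hηK hηY,
    velocityTruncation_of_tails_at (a₀ := fun _ => a) (θ₀ := fun _ => θ) (u₀ := fun _ => u)
      continuous_const continuous_const continuous_const (fun _ => ha) (fun _ => hθ) hηY hCY hK
      (velocityTailEnergy_rung0 a θ u ha hθ)⟩

/-! ## The registered helper stub -/

/-- **Rung 0 of (H_E)** (registered helper stub `stub_velocityTailEnergyRung0` of the line
`even-rung-mean-variance`, verbatim): for constant profiles `(a, u, θ)`, `a, θ > 0`, there is `σ₀ > 0`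
(`= 1/2`) such that for `0 < σ < σ₀`, every family of flows, `τ > 0` and `η > 0` there is `L₀` with
`∫ T_L(Φ_s z) dG_N(z) ≤ η` for all `L ≥ L₀`, `N ≥ N₀ = 0` and `s ∈ [0, τ]` (`velocityTailEnergy_rung0`).
[folklore] -/
theorem stub_velocityTailEnergyRung0 :
    ∀ (a θ : ℝ) (u : V3), 0 < a → 0 < θ → ∃ σ₀ : ℝ, 0 < σ₀ ∧ ∀ σ : ℝ, 0 < σ → σ < σ₀ → ∀ Φ : (N : ℕ) →
      HardSphereFlow (Torus.geometry (Fin 3)) (hsDiameter σ N) (N + 1), ∀ τ : ℝ, 0 < τ → ∀ η : ℝ, 0 < η →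
      ∃ L₀ : ℝ, ∀ L : ℝ, L₀ ≤ L → ∃ N₀ : ℕ, ∀ N : ℕ, N₀ ≤ N → ∀ s ∈ Set.Icc (0 : ℝ) τ, ∫⁻ z,
      ENNReal.ofReal (tailEnergy L ((Φ N).flow s z)) ∂(localGibbsLaw σ (fun _ => a) (fun _ => u) (fun _ =>
      θ) N (Φ N)) ≤ ENNReal.ofReal η :=
  fun a θ u ha hθ => velocityTailEnergy_rung0 a θ u ha hθ

end Summit.AtomisticToContinuum.HydrodynamicLimit.Theorems.EvenStressEnskog

end
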